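import Summits.BirchSwinnertonDyer.BirchSwinnertonDyer.Theorems.Rank2ObservatoryTwistCount
import HarnessLib

/-!
# BirchSwinnertonDyer — rank ≥ 2 observatory: the killer-certificate sum type (v2 wire-in point)

HONEST FRAMING: per-curve certified theorems and census instruments; no claim on BSD in rank ≥ 2.

One inductive `KillerCert` carrying the evidence for `#Ẽ(𝔽_q) = N` at a witness prime `q` in any of
the five certified forms — Euler count (`killerLTB`), order certificate (`orderCertB`), twist
certificate (`twistCertB`), two-point certificate (`orderCert2B`), twist two-point certificate
(`twistCert2B`) — with the dispatcher `KillerCert.check` and the single soundness theorem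
**`KillerCert.killerB_of_check : k.check V q N = true → killerB V (q, N) = true`**. A witness
structure that stores `kc : KillerCert` instead of `oc : Option (order certificate)` needs no other
change: its soundness proof calls `killerB_of_check` where it called `killerB_of_killer`.
Sorry-free; no `decide` executed in this file.

References: J. E. Cremona, *Algorithms for Modular Elliptic Curves* (1997) §2.4, §3.5;
J. H. Silverman, *The Arithmetic of Elliptic Curves* (2009) V.1, X.3.
-/

-- single-conjunct summit: `Summit.BirchSwinnertonDyer.BirchSwinnertonDyer.…` repeats the name
set_option linter.dupNamespace false

namespace Summit.BirchSwinnertonDyer.BirchSwinnertonDyer.Rank2Observatory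

/-- The evidence for the group order at a witness prime, in one of five certified forms.
[cite: CremonaAlgorithms1997, §2.4] -/
inductive KillerCert where
  /-- no certificate: certify `N` by the Euler–Legendre count (`killerLTB`, `O(q)` kernel work) -/
  | count : KillerCert
  /-- order certificate: `(X, Y)` of exact order `N > q + ½`, `fs` the factorisation of `N` -/
  | order (X Y : ℤ) (fs : List (ℕ × ℕ)) : KillerCert
  /-- twist certificate: `u` a non-residue, `(X, Y)` of exact order `2q + 2 − N` on the twist -/
  | twist (u X Y : ℤ) (fs : List (ℕ × ℕ)) : KillerCert
  /-- two-point certificate: `G = (X, Y)` of order `N / r`, `H = (X₂, Y₂)` of order `r ∈ {2, 3}` -/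
  | order₂ (X Y : ℤ) (fs : List (ℕ × ℕ)) (r : ℕ) (X₂ Y₂ : ℤ) : KillerCert
  /-- two-point certificate on the twist by the non-residue `u` -/
  | twist₂ (u X Y : ℤ) (fs : List (ℕ × ℕ)) (r : ℕ) (X₂ Y₂ : ℤ) : KillerCert

/-- The dispatcher: the Boolean certifying `#Ẽ(𝔽_q) = N` from the evidence `k`.
[cite: CremonaAlgorithms1997, §2.4] -/
def KillerCert.check (V : WeierstrassCurve ℤ) (q N : ℕ) : KillerCert → Bool
  | .count => killerLTB V (q, N)
  | .order X Y fs => orderCertB V (q, N, X, Y, fs)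
  | .twist u X Y fs => twistCertB V (q, N, u, X, Y, fs)
  | .order₂ X Y fs r X₂ Y₂ => orderCert2B V (q, N, X, Y, fs, r, X₂, Y₂)
  | .twist₂ u X Y fs r X₂ Y₂ => twistCert2B V (q, N, u, X, Y, fs, r, X₂, Y₂)

/-- **Every certified form gives the landed `killerB`** (same prime, same count). [folklore] -/
theorem KillerCert.killerB_of_check (V : WeierstrassCurve ℤ) {q N : ℕ} (k : KillerCert)
    (h : k.check V q N = true) : killerB V (q, N) = true := by
  cases k with
  | count => exact killerB_of_killerLB V (killerLB_of_killerLTB V h)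
  | order X Y fs => exact killerB_of_orderCertB V h
  | twist u X Y fs => exact killerB_of_twistCertB V h
  | order₂ X Y fs r X₂ Y₂ => exact killerB_of_orderCert2B V h
  | twist₂ u X Y fs r X₂ Y₂ => exact killerB_of_twistCert2B V h

/-- List form over `(q, N, certificate)` triples. [folklore] -/
theorem KillerCert.all_killerB_of_all_check (V : WeierstrassCurve ℤ)
    {S : List (ℕ × ℕ × KillerCert)} (h : S.all (fun c => c.2.2.check V c.1 c.2.1) = true) :
    (S.map fun c => (c.1, c.2.1)).all (killerB V) = true := by
  rw [List.all_eq_true] at h ⊢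
  intro x hx
  obtain ⟨c, hc, rfl⟩ := List.mem_map.mp hx
  exact KillerCert.killerB_of_check V c.2.2 (h c hc)

end Summit.BirchSwinnertonDyer.BirchSwinnertonDyer.Rank2Observatory
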